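import Summits.QuantumFields.YangMills.Theorems.UnitScaleTiltProp7CritEL
import Summits.QuantumFields.YangMills.Theorems.UnitScaleTiltProp8HalvingHcritTransfer
import Literature.MathematicalPhysics.QuantumFieldTheory.Balaban1983to89.T3PrintedRegularOrbits
import HarnessLib

/-!
# Route `UnitScaleTilt`, crux K1 child «MinimiserStabilityRegPr» (stmt-QuantumFields-19200), registered stub `stub_halvingStep` (H), the S11∕S12 junction of the
# end-to-end knit (census (H-E2E) v4, S12 (Φ-1)): **THE REGULARITY HALF OF (Φ-1) («S12b») COSTS NOTHING — competitors of the minimiser stay in print's regular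
# space `𝔘_k(ε₀)` along every line through the chart point, by OPENNESS, with a configuration-dependent radius; so the competitor set of
# ✓`tracePairing_of_isMinOn_dressed_wilson_su2` may be cut down to `S₀ ∩ {X | RegPr ε₀ (Φ X)}` (still open along lines), and the map-into-`regFibrePr` hypothesis `hΦ`
# of ✓`HalvingHcritTransfer.hmin_of_hcrit` reduces to its FIBRE half `Φ X ∈ 𝔅_k(V)`**

Cell `ym3-torus` (HUMAN RULING D-0037, YM ladder rung R3 — continuum SU(2) YM₃ on the torus is a RUNG, not the Clay problem), width seat `ym-ust-19200-w1` gen 7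
(★★OWNER ACK 40 census row (R2) of memo `CENSUS-H-RESIDUE-AFTER-a7a8-g265-w1g7.md`, 19200 evidence #45).  `--supports stmt-QuantumFields-19200 --as helper`; def-free,
0 sorry, standard axioms; counts toward nothing by itself.

WHY.  ✓`hmin_of_hcrit` transports «`U` minimises the Wilson action over `regFibrePr F n K _ ε₀ V = 𝔅_k(V) ∩ 𝔘_k(ε₀)`» to «`A′` minimises `X ↦ A(Φ X)` over a competitor set
`T`» under `hΦ : ∀ X ∈ T, Φ X ∈ regFibrePr …`, whose REGULARITY half (`RegPr ε₀ (Φ X)`: the strict plaquette clause (1.7) and the strict covariant-divergence clause (1.9)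
of [Balaban1985RegularSpaces] = [Balaban1985Variational] (2)) no pillar supplies (the P1♭ text of record ✓`HalvingP1FlatPillar` omits it BY DESIGN, ★w7-19200 g0
2026-08-28T08:10:43Z «S12b»).  It needs no estimate: `{W | RegPr ε₀ W}` is OPEN in `SU(2)^{bonds}` (✓`Prop7CritEL.isOpen_regPr` — finitely many strict inequalities of
continuous functions of the bond variables) and contains `Φ A′ = U^{u}` (✓`T3PrintedRegularOrbits.regPr_gaugeAct_iff`, [Balaban1985Variational] p.278 «the space
𝔘_k is gauge invariant»), so for every direction `δ` the line `t ↦ Φ (A′ + t•δ)`, continuous at `0`, stays in it for `|t| < r(δ)` — exactly the «open along lines» shape `hS₀`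
that ✓`HalvingDressedCriticalitySU2.tracePairing_of_isMinOn_dressed_wilson_su2` asks of its competitor set; the first variation needs ANY `r > 0`, so the `U`-dependence of the
radius is harmless.  (Print, [Balaban1985Variational] p.301: «a sufficiently small neighborhood of U′_k in (150) is contained in (6)».)

WHAT IS PROVED (ns `…Theorems.HalvingCompetitorRegularOpen`; `E := PBond (F.P K) 0 → M₂(ℂ)` the chart space, `Φ : E → SU(2)^{bonds}` ANY competitor map).
* §1 `exists_lineRadius_regPr` — `RegPr ε₀ (Φ A′)` + `ContinuousAt (t ↦ Φ (A′ + t•δ)) 0` ⟹ `∃ r > 0, ∀ |t| < r, RegPr ε₀ (Φ (A′ + t•δ))`;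
  `exists_lineRadius_regPr_of_differentiableAt_bonds` — the same from bondwise differentiability at `0` of the matrix entries (the datum the (98)∕(111) files carry;
  ✓`Prop7CritEL.continuousAt_of_differentiableAt_bonds`).
* §2 `lineOpen_inter_regPr` — if `S₁` is open along lines at `A′` (e.g. the weighted ball of the chart of record, ✓`exists_lineRadius_of_mem_weightedBall`), so is
  `S₁ ∩ {X | RegPr ε₀ (Φ X)}` — the `hS₀` binder of `tracePairing_of_isMinOn_dressed_wilson_su2` for the cut-down competitor set; `mem_inter_regPr` (`A′` itself lies in it).
* §3 `regPr_gaugeAct_of_mem_regFibrePr` — the centre: `U ∈ regFibrePr … ε₀ V ⟹ RegPr ε₀ (gaugeAct u U)` (`0 ≤ ε₀`).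
* §4 `mapsTo_regFibrePr_of_fibre` — on any set contained in `{X | RegPr ε₀ (Φ X)}`, `hΦ` of `hmin_of_hcrit` IS its fibre half; ★ `hmin_of_hcrit_regOpen` ∕ `hmin_of_hcrit_eq_regOpen` —
  ✓`hmin_of_hcrit`(∕`_eq`) with the competitor set `T ∩ {X | RegPr ε₀ (Φ X)}` and ONLY the fibre half `∀ X ∈ T ∩ {…}, Φ X ∈ fibre F ℰp n K _ V` displayed.
HONEST SCOPE: topology∕bookkeeping over landed theorems; the FIBRE half of (Φ-1) (the designed D-P1 mechanism) and the chart identity (Φ-2) are NOT touched here; nothing of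
print is asserted; NOT a claim about the stub, the crux, the rung or a mass gap.

References: T. Bałaban, CMP **102** (1985) 277–309 [Balaban1985Variational] ((2), (5)–(6) p.278, p.278 (gauge invariance of 𝔘_k), (150) p.301, p.301 («a sufficiently small
neighborhood of U′_k in (150) is contained in (6)»)); CMP **99** (1985) 75–102 [Balaban1985RegularSpaces] ((1.7), (1.9) p.77).
-/

set_option autoImplicit false

noncomputable section

open scoped Matrix.Norms.L2Operator Topology
open Filter

namespace Summit.QuantumFields.YangMills.Theorems.HalvingCompetitorRegularOpen

open Literature.MathematicalPhysics.QuantumFieldTheory.Balaban1983to89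
open Literature.MathematicalPhysics.QuantumFieldTheory.Balaban1983to89.T3ContinuumYM3Torus
open Literature.MathematicalPhysics.QuantumFieldTheory.Balaban1983to89.T3UnitLawDensityEML (ℰp)
open Literature.MathematicalPhysics.QuantumFieldTheory.Balaban1983to89.T3ConstrainedMinimiser (fibre)
open Literature.MathematicalPhysics.QuantumFieldTheory.Balaban1983to89.T3PrintedRegularMinimiser (RegPr regFibrePr mem_regFibrePr_iff)
open Literature.MathematicalPhysics.QuantumFieldTheory.Balaban1983to89.T3PrintedRegularOrbits (regPr_gaugeAct_iff)
open Summit.QuantumFields.YangMills.Theorems.Prop7CritEL (isOpen_regPr continuousAt_of_differentiableAt_bonds)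
open Summit.QuantumFields.YangMills.Theorems.HalvingHcritTransfer (hmin_of_hcrit hmin_of_hcrit_eq)

variable (F : T3Family) (n K : ℕ) (ε₀ : ℝ)

/-! ## §1 The regular space is met along every line through a regular point, for small parameters -/

section Line

variable (Φ : (PBond (F.P K) 0 → Matrix (Fin 2) (Fin 2) ℂ) → GaugeField (F.P K) 0 (Matrix.specialUnitaryGroup (Fin 2) ℂ))

/-- ★ **COMPETITORS STAY REGULAR ALONG A LINE**: if `Φ A′ ∈ 𝔘_k(ε₀)` (`RegPr`) and `t ↦ Φ (A′ + t•δ)` is continuous at `0` (in `SU(2)^{bonds}`), then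
`RegPr ε₀ (Φ (A′ + t•δ))` for all `|t| < r`, some `r > 0` — `𝔘_k(ε₀)` is open (✓`isOpen_regPr`).  The radius depends on the configuration; the first variation needs
any positive one. [cite: Balaban1985Variational, (2) p.278, p.301] -/
theorem exists_lineRadius_regPr (A' δ : PBond (F.P K) 0 → Matrix (Fin 2) (Fin 2) ℂ) (hreg : RegPr F n K ε₀ (Φ A'))
    (hcont : ContinuousAt (fun t : ℝ => Φ (A' + t • δ)) 0) :
    ∃ r : ℝ, 0 < r ∧ ∀ t : ℝ, |t| < r → RegPr F n K ε₀ (Φ (A' + t • δ)) := by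
  have hO : {U : GaugeField (F.P K) 0 (Matrix.specialUnitaryGroup (Fin 2) ℂ) | RegPr F n K ε₀ U} ∈ 𝓝 ((fun t : ℝ => Φ (A' + t • δ)) 0) := by
    have h0 : (fun t : ℝ => Φ (A' + t • δ)) 0 = Φ A' := by simp only [zero_smul, add_zero]
    rw [h0]
    exact (isOpen_regPr F n K ε₀).mem_nhds hreg
  have hev : ∀ᶠ t in 𝓝 (0 : ℝ), RegPr F n K ε₀ (Φ (A' + t • δ)) := hcont.preimage_mem_nhds hO
  obtain ⟨r, hr, h⟩ := Metric.eventually_nhds_iff.1 hev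
  refine ⟨r, hr, fun t ht => h ?_⟩
  rwa [Real.dist_eq, sub_zero]

/-- The same from BONDWISE DIFFERENTIABILITY at `0` of the matrix entries of the competitor curve (the datum carried by the (98)∕(111) files; continuity by
✓`Prop7CritEL.continuousAt_of_differentiableAt_bonds`). [cite: Balaban1985Variational, (2) p.278, p.301] -/
theorem exists_lineRadius_regPr_of_differentiableAt_bonds (A' δ : PBond (F.P K) 0 → Matrix (Fin 2) (Fin 2) ℂ) (hreg : RegPr F n K ε₀ (Φ A'))
    (hdiff : ∀ b : PBond (F.P K) 0,
      DifferentiableAt ℝ (fun t : ℝ => ((Φ (A' + t • δ) b : Matrix.specialUnitaryGroup (Fin 2) ℂ) : Matrix (Fin 2) (Fin 2) ℂ)) 0) :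
    ∃ r : ℝ, 0 < r ∧ ∀ t : ℝ, |t| < r → RegPr F n K ε₀ (Φ (A' + t • δ)) :=
  exists_lineRadius_regPr F n K ε₀ Φ A' δ hreg (continuousAt_of_differentiableAt_bonds (fun t : ℝ => Φ (A' + t • δ)) hdiff)

/-! ## §2 The cut-down competitor set `S₁ ∩ {X | RegPr ε₀ (Φ X)}` is open along lines -/

/-- ★ **THE `hS₀` BINDER FOR THE CUT-DOWN COMPETITOR SET**: if `S₁` is open along lines at `A′`, `Φ A′` is regular and every competitor line is continuous at `0`, then
`S₁ ∩ {X | RegPr ε₀ (Φ X)}` is open along lines at `A′` — the shape `∀ δ, ∃ r > 0, ∀ t, |t| < r → A′ + t•δ ∈ S₀` of ✓`tracePairing_of_isMinOn_dressed_wilson_su2`.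
[cite: Balaban1985Variational, (150) p.301, p.301] -/
theorem lineOpen_inter_regPr (S₁ : Set (PBond (F.P K) 0 → Matrix (Fin 2) (Fin 2) ℂ)) (A' : PBond (F.P K) 0 → Matrix (Fin 2) (Fin 2) ℂ)
    (hS₁ : ∀ δ : PBond (F.P K) 0 → Matrix (Fin 2) (Fin 2) ℂ, ∃ r : ℝ, 0 < r ∧ ∀ t : ℝ, |t| < r → A' + t • δ ∈ S₁)
    (hreg : RegPr F n K ε₀ (Φ A')) (hcont : ∀ δ : PBond (F.P K) 0 → Matrix (Fin 2) (Fin 2) ℂ, ContinuousAt (fun t : ℝ => Φ (A' + t • δ)) 0) :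
    ∀ δ : PBond (F.P K) 0 → Matrix (Fin 2) (Fin 2) ℂ, ∃ r : ℝ, 0 < r ∧ ∀ t : ℝ, |t| < r →
      A' + t • δ ∈ S₁ ∩ {X | RegPr F n K ε₀ (Φ X)} := by
  intro δ
  obtain ⟨r₁, hr₁, h₁⟩ := hS₁ δ
  obtain ⟨r₂, hr₂, h₂⟩ := exists_lineRadius_regPr F n K ε₀ Φ A' δ hreg (hcont δ)
  refine ⟨min r₁ r₂, lt_min hr₁ hr₂, fun t ht => ⟨h₁ t (lt_of_lt_of_le ht (min_le_left _ _)), ?_⟩⟩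
  exact h₂ t (lt_of_lt_of_le ht (min_le_right _ _))

/-- the bondwise-differentiable variant of `lineOpen_inter_regPr`. [cite: Balaban1985Variational, (150) p.301, p.301] -/
theorem lineOpen_inter_regPr_of_differentiableAt_bonds (S₁ : Set (PBond (F.P K) 0 → Matrix (Fin 2) (Fin 2) ℂ)) (A' : PBond (F.P K) 0 → Matrix (Fin 2) (Fin 2) ℂ)
    (hS₁ : ∀ δ : PBond (F.P K) 0 → Matrix (Fin 2) (Fin 2) ℂ, ∃ r : ℝ, 0 < r ∧ ∀ t : ℝ, |t| < r → A' + t • δ ∈ S₁)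
    (hreg : RegPr F n K ε₀ (Φ A'))
    (hdiff : ∀ (δ : PBond (F.P K) 0 → Matrix (Fin 2) (Fin 2) ℂ) (b : PBond (F.P K) 0),
      DifferentiableAt ℝ (fun t : ℝ => ((Φ (A' + t • δ) b : Matrix.specialUnitaryGroup (Fin 2) ℂ) : Matrix (Fin 2) (Fin 2) ℂ)) 0) :
    ∀ δ : PBond (F.P K) 0 → Matrix (Fin 2) (Fin 2) ℂ, ∃ r : ℝ, 0 < r ∧ ∀ t : ℝ, |t| < r →
      A' + t • δ ∈ S₁ ∩ {X | RegPr F n K ε₀ (Φ X)} :=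
  lineOpen_inter_regPr F n K ε₀ Φ S₁ A' hS₁ hreg fun δ => continuousAt_of_differentiableAt_bonds (fun t : ℝ => Φ (A' + t • δ)) (hdiff δ)

/-- the chart point itself lies in the cut-down set. [cite: Balaban1985Variational, (150) p.301] -/
theorem mem_inter_regPr {S₁ : Set (PBond (F.P K) 0 → Matrix (Fin 2) (Fin 2) ℂ)} {A' : PBond (F.P K) 0 → Matrix (Fin 2) (Fin 2) ℂ}
    (hA : A' ∈ S₁) (hreg : RegPr F n K ε₀ (Φ A')) : A' ∈ S₁ ∩ {X | RegPr F n K ε₀ (Φ X)} :=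
  ⟨hA, hreg⟩

end Line

/-! ## §3 The centre of the chart is regular -/

/-- **THE CENTRE IS REGULAR**: `U ∈ 𝔅_k(V) ∩ 𝔘_k(ε₀)` ⟹ every gauge copy `U^{u}` lies in `𝔘_k(ε₀)` (`0 ≤ ε₀`; [Balaban1985Variational] p.278 «the space 𝔘_k is gauge
invariant», ✓`regPr_gaugeAct_iff`). [cite: Balaban1985Variational, p.278, (6) p.278] -/
theorem regPr_gaugeAct_of_mem_regFibrePr {hnK : n ≤ K} (hε : 0 ≤ ε₀) {V : GaugeField (F.P n) 0 (Matrix.specialUnitaryGroup (Fin 2) ℂ)}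
    {U : GaugeField (F.P K) 0 (Matrix.specialUnitaryGroup (Fin 2) ℂ)} (hU : U ∈ regFibrePr F n K hnK ε₀ V)
    (u : GaugeTransf (F.P K) 0 (Matrix.specialUnitaryGroup (Fin 2) ℂ)) : RegPr F n K ε₀ (GaugeField.gaugeAct u U) :=
  (regPr_gaugeAct_iff F hε u U).2 ((mem_regFibrePr_iff F).1 hU).2

/-! ## §4 `hmin_of_hcrit` with only the FIBRE half of (Φ-1) displayed -/

section Hmin

variable {F n K ε₀}
variable (Φ : (PBond (F.P K) 0 → Matrix (Fin 2) (Fin 2) ℂ) → GaugeField (F.P K) 0 (Matrix.specialUnitaryGroup (Fin 2) ℂ))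

/-- **ON A SET OF REGULAR COMPETITORS, «MAPS INTO `regFibrePr`» IS ITS FIBRE HALF**: `∀ X ∈ T ∩ {RegPr ε₀ (Φ X)}, Φ X ∈ 𝔅_k(V)` ⟹
`∀ X ∈ T ∩ {RegPr ε₀ (Φ X)}, Φ X ∈ regFibrePr … ε₀ V`. [cite: Balaban1985Variational, (6) p.278] -/
theorem mapsTo_regFibrePr_of_fibre {hnK : n ≤ K} {V : GaugeField (F.P n) 0 (Matrix.specialUnitaryGroup (Fin 2) ℂ)}
    (T : Set (PBond (F.P K) 0 → Matrix (Fin 2) (Fin 2) ℂ)) (hfib : ∀ X ∈ T ∩ {X | RegPr F n K ε₀ (Φ X)}, Φ X ∈ fibre F ℰp n K hnK V) :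
    ∀ X ∈ T ∩ {X | RegPr F n K ε₀ (Φ X)}, Φ X ∈ regFibrePr F n K hnK ε₀ V :=
  fun X hX => (mem_regFibrePr_iff F).2 ⟨hfib X hX, hX.2⟩

/-- ★ **`hmin_of_hcrit` WITH THE REGULARITY HALF OF (Φ-1) DISCHARGED**: if `U` minimises the Wilson action over print's regular fibre, `Φ A′ = U^{u}`, and on the cut-down
competitor set `T ∩ {X | RegPr ε₀ (Φ X)}` the competitors lie in the FIBRE `𝔅_k(V)` (the designed D-P1 half of (Φ-1), displayed), then `A′` minimises `X ↦ A(Φ X)` over that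
set.  Together with §2 (the set is open along lines) this is the `hmin`∕`hS₀` pair of ✓`tracePairing_of_isMinOn_dressed_wilson_su2`. [cite: Balaban1985Variational, (150) p.301, (157) p.302, p.301] -/
theorem hmin_of_hcrit_regOpen (hnK : n ≤ K) (ε₀ : ℝ) (V : GaugeField (F.P n) 0 (Matrix.specialUnitaryGroup (Fin 2) ℂ))
    {U : GaugeField (F.P K) 0 (Matrix.specialUnitaryGroup (Fin 2) ℂ)}
    (hcrit : IsMinOn (fun W : GaugeField (F.P K) 0 (Matrix.specialUnitaryGroup (Fin 2) ℂ) => wilsonAction4 W) (regFibrePr F n K hnK ε₀ V) U)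
    (T : Set (PBond (F.P K) 0 → Matrix (Fin 2) (Fin 2) ℂ))
    (hfib : ∀ X ∈ T ∩ {X | RegPr F n K ε₀ (Φ X)}, Φ X ∈ fibre F ℰp n K hnK V)
    {A' : PBond (F.P K) 0 → Matrix (Fin 2) (Fin 2) ℂ} (u : GaugeTransf (F.P K) 0 (Matrix.specialUnitaryGroup (Fin 2) ℂ))
    (hΦA : Φ A' = GaugeField.gaugeAct u U) :
    IsMinOn (fun X => wilsonAction4 (Φ X)) (T ∩ {X | RegPr F n K ε₀ (Φ X)}) A' :=
  hmin_of_hcrit hnK ε₀ V hcrit (T ∩ {X | RegPr F n K ε₀ (Φ X)}) Φ (mapsTo_regFibrePr_of_fibre Φ T hfib) u hΦA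

/-- the variant with the chart hitting the minimiser literally (`Φ A′ = U`). [cite: Balaban1985Variational, (150) p.301, (157) p.302] -/
theorem hmin_of_hcrit_eq_regOpen (hnK : n ≤ K) (ε₀ : ℝ) (V : GaugeField (F.P n) 0 (Matrix.specialUnitaryGroup (Fin 2) ℂ))
    {U : GaugeField (F.P K) 0 (Matrix.specialUnitaryGroup (Fin 2) ℂ)}
    (hcrit : IsMinOn (fun W : GaugeField (F.P K) 0 (Matrix.specialUnitaryGroup (Fin 2) ℂ) => wilsonAction4 W) (regFibrePr F n K hnK ε₀ V) U)
    (T : Set (PBond (F.P K) 0 → Matrix (Fin 2) (Fin 2) ℂ))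
    (hfib : ∀ X ∈ T ∩ {X | RegPr F n K ε₀ (Φ X)}, Φ X ∈ fibre F ℰp n K hnK V)
    {A' : PBond (F.P K) 0 → Matrix (Fin 2) (Fin 2) ℂ} (hΦA : Φ A' = U) :
    IsMinOn (fun X => wilsonAction4 (Φ X)) (T ∩ {X | RegPr F n K ε₀ (Φ X)}) A' :=
  hmin_of_hcrit_eq hnK ε₀ V hcrit (T ∩ {X | RegPr F n K ε₀ (Φ X)}) Φ (mapsTo_regFibrePr_of_fibre Φ T hfib) hΦA

/-- ★ **THE S12 PACKAGE FOR THE E2E KNIT**: from the minimiser `U ∈ regFibrePr … ε₀ V`, `0 ≤ ε₀`, a competitor map with `Φ A′ = U^{u}`, a line-open set `S₁ ∋ A′`, continuity of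
the competitor lines at `0`, and the FIBRE half of (Φ-1) on `T ∩ (S₁ ∩ {RegPr})`-competitors: the three binders `hmin`, `hS₀`, `hAS` of
✓`tracePairing_of_isMinOn_dressed_wilson_su2` for `S₀ := S₁ ∩ {X | RegPr ε₀ (Φ X)}` (its `T` is `{sa ∧ tr ∧ averages} ∩ S₀`; intersect in whatever order — the three facts
are stated for the set `T ∩ S₀`). [cite: Balaban1985Variational, (150) p.301, (157) p.302, p.278, p.301] -/
theorem s12_package (hnK : n ≤ K) (hε : 0 ≤ ε₀) (V : GaugeField (F.P n) 0 (Matrix.specialUnitaryGroup (Fin 2) ℂ))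
    {U : GaugeField (F.P K) 0 (Matrix.specialUnitaryGroup (Fin 2) ℂ)} (hU : U ∈ regFibrePr F n K hnK ε₀ V)
    (hcrit : IsMinOn (fun W : GaugeField (F.P K) 0 (Matrix.specialUnitaryGroup (Fin 2) ℂ) => wilsonAction4 W) (regFibrePr F n K hnK ε₀ V) U)
    (T S₁ : Set (PBond (F.P K) 0 → Matrix (Fin 2) (Fin 2) ℂ)) {A' : PBond (F.P K) 0 → Matrix (Fin 2) (Fin 2) ℂ}
    (u : GaugeTransf (F.P K) 0 (Matrix.specialUnitaryGroup (Fin 2) ℂ)) (hΦA : Φ A' = GaugeField.gaugeAct u U) (hA : A' ∈ S₁)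
    (hS₁ : ∀ δ : PBond (F.P K) 0 → Matrix (Fin 2) (Fin 2) ℂ, ∃ r : ℝ, 0 < r ∧ ∀ t : ℝ, |t| < r → A' + t • δ ∈ S₁)
    (hcont : ∀ δ : PBond (F.P K) 0 → Matrix (Fin 2) (Fin 2) ℂ, ContinuousAt (fun t : ℝ => Φ (A' + t • δ)) 0)
    (hfib : ∀ X ∈ T ∩ (S₁ ∩ {X | RegPr F n K ε₀ (Φ X)}), Φ X ∈ fibre F ℰp n K hnK V) :
    IsMinOn (fun X => wilsonAction4 (Φ X)) (T ∩ (S₁ ∩ {X | RegPr F n K ε₀ (Φ X)})) A' ∧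
      (∀ δ : PBond (F.P K) 0 → Matrix (Fin 2) (Fin 2) ℂ, ∃ r : ℝ, 0 < r ∧ ∀ t : ℝ, |t| < r → A' + t • δ ∈ S₁ ∩ {X | RegPr F n K ε₀ (Φ X)}) ∧
      A' ∈ S₁ ∩ {X | RegPr F n K ε₀ (Φ X)} := by
  have hreg : RegPr F n K ε₀ (Φ A') := by
    rw [hΦA]; exact regPr_gaugeAct_of_mem_regFibrePr F n K ε₀ hε hU u
  refine ⟨?_, lineOpen_inter_regPr F n K ε₀ Φ S₁ A' hS₁ hreg hcont, mem_inter_regPr F n K ε₀ Φ hA hreg⟩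
  have hsub : ∀ X ∈ T ∩ (S₁ ∩ {X | RegPr F n K ε₀ (Φ X)}), Φ X ∈ regFibrePr F n K hnK ε₀ V :=
    fun X hX => (mem_regFibrePr_iff F).2 ⟨hfib X hX, hX.2.2⟩
  exact hmin_of_hcrit hnK ε₀ V hcrit _ Φ hsub u hΦA

end Hmin

end Summit.QuantumFields.YangMills.Theorems.HalvingCompetitorRegularOpen

end
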